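import Summits.HubbardSuperconductivity.HubbardLadder.Bounds.PairCorrelationEtaLineDipole
import Summits.HubbardSuperconductivity.HubbardLadder.Bounds.PairCorrelationEtaLine
import Literature.MathematicalPhysics.QuantumLattice.TorusEuclidLogDipole
import Mathlib.Order.LiminfLimsup
import HarnessLib
import HarnessLib.Audit

/-!
# Hubbard ladder — Bounds: the sharp Koma–Tasaki `η`-line `T > (π/4)|t|`, machine-checked
# (bounds.tex Thm 10 (iii) / Cor 10.1; sequel to `PairCorrelationEtaLineDipole.lean`)

HONEST FRAMING (cell pub-hubbard): ladder R1–R4 with certified numbers; no claim on H/H₀. These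
are bounds for a MODEL CLASS — the grand-canonical Hubbard model `hubbardTorusWith 2 L t U μ` on
the square torus `(ℤ/Lℤ)²` (every `L ≥ 1`, all real `t, U, μ`, every `β > 0`); no materials
claim. Companion text: `pub-hubbard/paper/bounds.tex` §Theorem 10; tables
`pub-hubbard/pub-hubbard-bounds/BOUNDS.md` (rows T8–T8‴, C2) and `EXTREMISERS.md` §5c.

## Content

`PairCorrelationEtaLine.lean` typed the paper's sharp statement `PairEtaLineSharp`
(thermodynamic-limit decay exponent `≥ (1-ε)/(π β |t|)`, the McBryan–Spencer value with
Koma–Tasaki's printed hopping norm) WITHOUT a proof (the paper argues with the harmonic dipole,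
i.e. the lattice Green's function, absent from Mathlib); `PairCorrelationEtaLineDipole.lean`
machine-checked the `ℓ^∞` dipole instead, which caps at `T > 1.008|t|` (`8` bonds per unit of
`log` against the Euclidean `2π`). This file closes the gap with NO lattice Green's function: the
explicit EUCLIDEAN truncated logarithmic dipole `exists_euclidLogDipole` (Literature
`TorusEuclidLogDipole`; gain `2q log ρ`, energy `≤ 2(2π q² H(ρ) + 76 q² + 544 q⁴ e^{2q²})`,
`H(ρ) ≤ 1 + log ρ`) has the sharp gain/energy ratio. In the a priori gauge bound with
hopping-norm constant `a` (`apriori_one`: `a = 1`, Koma–Tasaki eq. (11) as printed) it gives,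
for every `q ≥ 0` with `f := 4q - 4π a β|t| q² ≥ 0`, uniformly in `L`
(`norm_pairCorr_le_rpow_euclid_of_apriori`, `norm_pairCorr_le_rpow_euclid`):
`|G_{β,L}(x,y)| ≤ K(q) 5^f (dist(x,y)+1)^{-f}`, `K(q) = exp[2aβ|t|(2π q² + 76 q² + 544 q⁴ e^{2q²})]`.
The optimum `q* = 1/(2π a β|t|)` gives `f* = 1/(π a β|t|)` — for `a = 1` exactly the exponent
of `PairEtaLineSharp`. Proved here:

* `PairEtaLineEuclid` / `pairEtaLineEuclid_holds` — torus-uniform form: `β|t| < 4/π`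
  (`T > (π/4)|t| ≈ 0.785|t|`) ⟹ `∃ f > 1/4, C`: `|G_{β,L}(x,y)| ≤ C (dist+1)^{-f}` for all
  `L, x, y` (and all `U, μ`);
* `pairEtaLineSharp_holds : PairEtaLineSharp` — the paper's Thm 10 (iii) (Koma–Tasaki's Theorem
  with the factor-2-improved exponent) in the `limsup_{L→∞}` form typed in
  `PairCorrelationEtaLine.lean` (the `ε`-slack absorbs `K(q*) (5√2)^{f*}`; at `t = 0` the
  exponent is the junk value `0` and the bound `1` holds).

NOT claimed: optimality of `1/(πβ|t|)` within the method (bounds.tex Thm 10 (iv), harmonic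
dipole — not machine-checked), and anything at `T < (π/4)|t|`. Reading (Cor 10.1): for
`T > (π/4)|t|` the pair correlations of the 2D Hubbard model decay faster than the
Nelson–Kosterlitz borderline `r^{-1/4}`, whatever `U` and the filling — a KT pair
quasi-condensate (`η ≤ 1/4`) can only occur at `T ≤ (π/4)|t|`; unconditional, machine-checked.

References (keys of `lean/references.bib`): KomaTasakiPRL1992 (Theorem, eqs. (11)–(13), note 9);
McBryanSpencer1977; NelsonKosterlitz1977; FriedliVelenikSMLS2017 §3.1.
-/

noncomputable section

namespace Summit.HubbardSuperconductivity.HubbardLadder.Bounds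

open Matrix Finset NormedSpace
open Literature.MathematicalPhysics.QuantumLattice Literature.Probability.LatticeModels
open scoped Matrix.Norms.L2Operator ComplexOrder

/-! ### From an a priori gauge bound to the sharp power law -/

/-- **Euclidean-dipole form of the Koma–Tasaki bound, parametric in the hopping-norm constant
`a`.** Suppose the thermal pair correlation of `hubbardTorusWith 2 L t U μ` obeys, for every real
site function `φ`, the a priori gauge bound
`|G_{β,L}(x,y)| ≤ e^{-2(φ_x - φ_y)} exp[β |t| a Σ_u Σ_v [u∼v] (cosh(φ_u - φ_v) - 1)]`.
Then for every `q ≥ 0` with `f := 4q - 4π a β|t| q² ≥ 0`: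
`|G_{β,L}(x,y)| ≤ K(q) 5^f (dist(x,y) + 1)^{-f}`,
`K(q) = exp[2aβ|t|(2π q² + 76 q² + 544 q⁴ e^{2q²})]`, uniformly in `L` (Euclidean dipole of
radius `ρ = ⌊(dist - 1)/2⌋ ≥ (dist+1)/5`, `H(ρ) ≤ 1 + log ρ`). -/
theorem norm_pairCorr_le_rpow_euclid_of_apriori (L : ℕ) [NeZero L] (t U μ β a q : ℝ)
    (hβ : 0 ≤ β) (ha : 0 ≤ a) (hq : 0 ≤ q) (x y : TorusSite 2 L)
    (hAP : ∀ φ : TorusSite 2 L → ℝ,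
      ‖(hubbardTorusWith 2 L t U μ).thermalCorr β (onSitePair x)ᴴ (onSitePair y)‖ ≤
        Real.exp (-2 * (φ x - φ y)) * Real.exp (β * (|t| * (a *
          ∑ u : TorusSite 2 L, ∑ v : TorusSite 2 L,
            (if (torusGraph 2 L).Adj u v then (Real.cosh (φ u - φ v) - 1) else 0)))))
    (hf : 0 ≤ 4 * q - 4 * Real.pi * a * (β * |t|) * q ^ 2) :
    ‖(hubbardTorusWith 2 L t U μ).thermalCorr β (onSitePair x)ᴴ (onSitePair y)‖ ≤
      Real.exp (2 * a * (β * |t|) *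
          (2 * Real.pi * q ^ 2 + 76 * q ^ 2 + 544 * q ^ 4 * Real.exp (2 * q ^ 2))) *
        ((5 : ℝ) ^ (4 * q - 4 * Real.pi * a * (β * |t|) * q ^ 2) *
          ((torusDist x y : ℝ) + 1) ^ (-(4 * q - 4 * Real.pi * a * (β * |t|) * q ^ 2))) := by
  set f : ℝ := 4 * q - 4 * Real.pi * a * (β * |t|) * q ^ 2 with hfdef
  have hf0 : 0 ≤ f := hf
  set K : ℝ := Real.exp (2 * a * (β * |t|) *
    (2 * Real.pi * q ^ 2 + 76 * q ^ 2 + 544 * q ^ 4 * Real.exp (2 * q ^ 2))) with hK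
  have hβt : 0 ≤ β * |t| := by positivity
  have hK1 : 1 ≤ K := Real.one_le_exp (by positivity)
  set R : ℕ := torusDist x y with hR
  have hR1 : (0 : ℝ) < (R : ℝ) + 1 := by positivity
  by_cases hR3 : R < 3
  · -- short distances: the bound with `φ = 0` is `1 ≤ K 5^f (R+1)^{-f}` (`R + 1 ≤ 5`)
    have h0 := hAP (fun _ => 0)
    simp only [sub_self, mul_zero, Real.cosh_zero, ite_self, sum_const_zero, Real.exp_zero,
      mul_one] at h0
    have hge1 : 1 ≤ (5 : ℝ) ^ f * ((R : ℝ) + 1) ^ (-f) := by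
      rw [Real.rpow_neg hR1.le, ← div_eq_mul_inv, ← Real.div_rpow (by norm_num) hR1.le]
      refine Real.one_le_rpow ?_ hf0
      rw [le_div_iff₀ hR1]
      have : (R : ℝ) ≤ 2 := by exact_mod_cast (by omega : R ≤ 2)
      linarith
    calc ‖(hubbardTorusWith 2 L t U μ).thermalCorr β (onSitePair x)ᴴ (onSitePair y)‖
        ≤ 1 := h0
      _ ≤ K * ((5 : ℝ) ^ f * ((R : ℝ) + 1) ^ (-f)) := by nlinarith
  · -- the Euclidean dipole of radius `ρ = ⌊(R-1)/2⌋ ≥ 1`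
    have hR3' : 3 ≤ R := not_lt.1 hR3
    set ρ : ℕ := (R - 1) / 2 with hρdef
    have hρ1 : 1 ≤ ρ := by omega
    have hρR : 2 * ρ + 1 ≤ torusDist x y := by rw [← hR]; omega
    have h5ρ : R + 1 ≤ 5 * ρ := by omega
    obtain ⟨φ, hgain, hE⟩ := exists_euclidLogDipole L x y q hq ρ hρ1 hρR
    have key := hAP φ
    rw [hgain] at key
    have hρ0 : (0 : ℝ) < (ρ : ℝ) := by exact_mod_cast hρ1
    have hH : (harmonic ρ : ℝ) ≤ 1 + Real.log ρ := harmonic_le_one_add_log ρ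
    have hfifth : ((R : ℝ) + 1) / 5 ≤ (ρ : ℝ) := by
      have h' : ((R : ℝ) + 1) ≤ 5 * (ρ : ℝ) := by exact_mod_cast h5ρ
      linarith
    have hfifth0 : (0 : ℝ) < ((R : ℝ) + 1) / 5 := by positivity
    calc ‖(hubbardTorusWith 2 L t U μ).thermalCorr β (onSitePair x)ᴴ (onSitePair y)‖
        ≤ Real.exp (-2 * (2 * q * Real.log ρ)) * Real.exp (β * (|t| * (a *
            ∑ u : TorusSite 2 L, ∑ v : TorusSite 2 L,
              (if (torusGraph 2 L).Adj u v then (Real.cosh (φ u - φ v) - 1) else 0)))) := key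
      _ ≤ Real.exp (-2 * (2 * q * Real.log ρ)) * Real.exp (β * (|t| * (a *
            (2 * (2 * Real.pi * q ^ 2 * (harmonic ρ : ℝ) + 76 * q ^ 2 +
              544 * q ^ 4 * Real.exp (2 * q ^ 2)))))) := by
          gcongr
      _ ≤ Real.exp (-2 * (2 * q * Real.log ρ)) * Real.exp (β * (|t| * (a *
            (2 * (2 * Real.pi * q ^ 2 * (1 + Real.log ρ) + 76 * q ^ 2 +
              544 * q ^ 4 * Real.exp (2 * q ^ 2)))))) := by
          gcongr
      _ = K * Real.exp (-(f * Real.log ρ)) := by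
          rw [hK, ← Real.exp_add, ← Real.exp_add, hfdef]
          congr 1
          ring
      _ = K * (ρ : ℝ) ^ (-f) := by
          rw [Real.rpow_def_of_pos hρ0]
          congr 2
          ring
      _ ≤ K * (((R : ℝ) + 1) / 5) ^ (-f) := by
          gcongr K * ?_
          exact Real.rpow_le_rpow_of_nonpos hfifth0 hfifth (by linarith)
      _ = K * ((5 : ℝ) ^ f * ((R : ℝ) + 1) ^ (-f)) := by
          rw [Real.div_rpow hR1.le (by norm_num), Real.rpow_neg (by norm_num : (0:ℝ) ≤ 5),
            div_inv_eq_mul, mul_comm (((R : ℝ) + 1) ^ (-f))]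

/-- **The sharp explicit bound (Koma–Tasaki's printed hopping norm, `a = 1`; machine-checked).**
For the nearest-neighbour Hubbard model on `(ℤ/Lℤ)²`, all real `t, U, μ`, every `β ≥ 0`, every
`q ≥ 0` with `f := 4q - 4π β|t| q² ≥ 0`, and all sites `x, y`:
`|⟨c†_{x↑}c†_{x↓}c_{y↓}c_{y↑}⟩_{β,L}| ≤ K(q) 5^f (dist(x,y)+1)^{-f}`,
`K(q) = exp[2β|t|(2π q² + 76 q² + 544 q⁴ e^{2q²})]`, uniformly in `L`. At `q = 1/(2πβ|t|)`
the exponent is the McBryan–Spencer/Koma–Tasaki value `1/(πβ|t|)` (bounds.tex Thm 10 (iii)). -/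
theorem norm_pairCorr_le_rpow_euclid (L : ℕ) [NeZero L] (t U μ β q : ℝ) (hβ : 0 ≤ β)
    (hq : 0 ≤ q) (hf : 0 ≤ 4 * q - 4 * Real.pi * 1 * (β * |t|) * q ^ 2) (x y : TorusSite 2 L) :
    ‖(hubbardTorusWith 2 L t U μ).thermalCorr β (onSitePair x)ᴴ (onSitePair y)‖ ≤
      Real.exp (2 * 1 * (β * |t|) *
          (2 * Real.pi * q ^ 2 + 76 * q ^ 2 + 544 * q ^ 4 * Real.exp (2 * q ^ 2))) *
        ((5 : ℝ) ^ (4 * q - 4 * Real.pi * 1 * (β * |t|) * q ^ 2) *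
          ((torusDist x y : ℝ) + 1) ^ (-(4 * q - 4 * Real.pi * 1 * (β * |t|) * q ^ 2))) :=
  norm_pairCorr_le_rpow_euclid_of_apriori L t U μ β 1 q hβ zero_le_one hq x y
    (apriori_one L t U μ β hβ x y) hf

/-! ### The sharp `η`-line, torus-uniform form -/

/-- **Cor 10.1‴ (torus form, sharp constant; PROVED below).** Nearest-neighbour Hubbard model on
`(ℤ/Lℤ)²`, any real `t, U, μ`, `β > 0` with `β|t| < 4/π` (temperature `T > (π/4)|t| ≈ 0.785|t|`,
the McBryan–Spencer/Koma–Tasaki `η = 1/4` line with the printed hopping norm): there are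
`f > 1/4` and `C` with `|G_{β,L}(x,y)| ≤ C (dist(x,y)+1)^{-f}` for all `L, x, y` — no KT pair
quasi-condensate (`η ≤ 1/4`) there, whatever `U`, `μ`. Improves `PairEtaLineDipoleSharp`
(`T ≥ 1.02|t|`) by the factor `4/π` (Euclidean against `ℓ^∞` shells). kind: support (PROVED).
Why it might fail: it cannot (proved); NOT claimed: optimality of the exponent within the method
(bounds.tex Thm 10 (iv)). Sources: KomaTasakiPRL1992 Theorem, eqs. (11)–(13), note 9;
McBryanSpencer1977; NelsonKosterlitz1977; this cell bounds.tex Thm 10. -/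
@[conjecture] def PairEtaLineEuclid : Prop :=
  ∀ (t U μ β : ℝ), 0 < β → β * |t| < 4 / Real.pi →
    ∃ f C : ℝ, 1 / 4 < f ∧ ∀ (L : ℕ) [NeZero L] (x y : TorusSite 2 L),
      ‖(hubbardTorusWith 2 L t U μ).thermalCorr β (onSitePair x)ᴴ (onSitePair y)‖ ≤
        C * ((torusDist x y : ℝ) + 1) ^ (-f)

/-- **`PairEtaLineEuclid` holds** (witness `q = 1/4` when `πβ|t| ≤ 2`, `f = 1 - πβ|t|/4 ≥ 1/2`;
else `q = 1/(2πβ|t|)`, `f = 1/(πβ|t|) > 1/4`; `C = K(q) 5^f`). -/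
theorem pairEtaLineEuclid_holds : PairEtaLineEuclid := by
  intro t U μ β hβ hb
  have hβt : 0 ≤ β * |t| := mul_nonneg hβ.le (abs_nonneg t)
  have hπ := Real.pi_pos
  have hb4 : Real.pi * (β * |t|) < 4 := by
    have := (lt_div_iff₀ hπ).1 hb
    linarith
  by_cases hc : Real.pi * (β * |t|) ≤ 2
  · -- `q = 1/4`
    have hf0 : 0 ≤ 4 * (1 / 4 : ℝ) - 4 * Real.pi * 1 * (β * |t|) * (1 / 4 : ℝ) ^ 2 := by
      nlinarith
    refine ⟨4 * (1 / 4 : ℝ) - 4 * Real.pi * 1 * (β * |t|) * (1 / 4 : ℝ) ^ 2,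
      Real.exp (2 * 1 * (β * |t|) * (2 * Real.pi * (1 / 4 : ℝ) ^ 2 + 76 * (1 / 4 : ℝ) ^ 2 +
        544 * (1 / 4 : ℝ) ^ 4 * Real.exp (2 * (1 / 4 : ℝ) ^ 2))) *
        (5 : ℝ) ^ (4 * (1 / 4 : ℝ) - 4 * Real.pi * 1 * (β * |t|) * (1 / 4 : ℝ) ^ 2),
      by nlinarith, fun L _ x y => ?_⟩
    rw [mul_assoc]
    exact norm_pairCorr_le_rpow_euclid L t U μ β (1 / 4) hβ.le (by norm_num) hf0 x y
  · -- `q = q* = 1/(2πβ|t|)`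
    have hc' : 2 < Real.pi * (β * |t|) := not_le.1 hc
    have hb0 : 0 < β * |t| := by
      rcases hβt.eq_or_lt with h | h
      · rw [← h, mul_zero] at hc'; linarith
      · exact h
    set q : ℝ := 1 / (2 * Real.pi * (β * |t|)) with hq
    have hq0 : 0 ≤ q := by positivity
    have hfval : 4 * q - 4 * Real.pi * 1 * (β * |t|) * q ^ 2 = 1 / (Real.pi * (β * |t|)) := by
      rw [hq]
      field_simp
      ring
    have hf4 : 1 / 4 < 4 * q - 4 * Real.pi * 1 * (β * |t|) * q ^ 2 := by
      rw [hfval, div_lt_div_iff₀ (by norm_num) (by positivity)]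
      linarith
    refine ⟨4 * q - 4 * Real.pi * 1 * (β * |t|) * q ^ 2,
      Real.exp (2 * 1 * (β * |t|) * (2 * Real.pi * q ^ 2 + 76 * q ^ 2 +
        544 * q ^ 4 * Real.exp (2 * q ^ 2))) *
        (5 : ℝ) ^ (4 * q - 4 * Real.pi * 1 * (β * |t|) * q ^ 2), hf4, fun L _ x y => ?_⟩
    rw [mul_assoc]
    exact norm_pairCorr_le_rpow_euclid L t U μ β q hβ.le hq0 (by linarith) x y

/-! ### The sharp statement `PairEtaLineSharp` (thermodynamic-limit form) — PROVED -/

/-- The cyclic absolute value of the residue of `k ∈ ℤ` mod `M` is `|k|` when `2|k| < M`.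
[folklore] -/
theorem cyclicAbs_intCast (M : ℕ) [NeZero M] (k : ℤ) (hk : 2 * k.natAbs < M) :
    min ((k : ZMod M)).val (M - ((k : ZMod M)).val) = k.natAbs := by
  have hn : ∀ n : ℕ, 2 * n < M → min ((n : ZMod M)).val (M - ((n : ZMod M)).val) = n := by
    intro n hn
    rw [ZMod.val_cast_of_lt (by omega)]
    omega
  rcases Int.natAbs_eq k with h | h
  · conv_lhs => rw [h]
    rw [Int.cast_natCast]
    exact hn _ hk
  · conv_lhs => rw [h]
    rw [Int.cast_neg, Int.cast_natCast, cyclicAbs_neg]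
    exact hn _ hk

/-- For `M > 2 max(|z₀|,|z₁|)` the torus distance from `0` to the residue of `z ∈ ℤ²` in
`(ℤ/Mℤ)²` is `max(|z₀|,|z₁|)`. [folklore] -/
theorem torusDist_torusSiteOfInt_zero (M : ℕ) [NeZero M] (z : Fin 2 → ℤ)
    (hz : 2 * max (z 0).natAbs (z 1).natAbs < M) :
    torusDist (torusSiteOfInt M 0) (torusSiteOfInt M z) = max (z 0).natAbs (z 1).natAbs := by
  rw [torusDist, torusNorm_two_eq_max]
  have hi : ∀ i, (torusSiteOfInt M 0 - torusSiteOfInt M z) i = (((-z i : ℤ)) : ZMod M) := by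
    intro i
    simp [torusSiteOfInt]
  rw [hi 0, hi 1, cyclicAbs_intCast M (-z 0) (by rw [Int.natAbs_neg]; omega),
    cyclicAbs_intCast M (-z 1) (by rw [Int.natAbs_neg]; omega), Int.natAbs_neg, Int.natAbs_neg]

/-- `|z| ≤ √2 · max(|z₀|,|z₁|)` for `z ∈ ℤ²`. [folklore] -/
theorem intNorm_le_sqrt_two_mul (z : Fin 2 → ℤ) :
    intNorm z ≤ Real.sqrt 2 * (max (z 0).natAbs (z 1).natAbs : ℕ) := by
  set m : ℕ := max (z 0).natAbs (z 1).natAbs with hm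
  have hcast : ∀ k : ℤ, ((k.natAbs : ℕ) : ℝ) = |(k : ℝ)| := fun k => by
    rw [← Int.cast_natCast, Int.natCast_natAbs, Int.cast_abs]
  have hsq : ∀ k : ℤ, k.natAbs ≤ m → ((k : ℤ) : ℝ) ^ 2 ≤ (m : ℝ) ^ 2 := by
    intro k hk
    have h1 : ((k.natAbs : ℕ) : ℝ) ≤ m := by exact_mod_cast hk
    rw [hcast] at h1
    rw [← sq_abs]
    exact pow_le_pow_left₀ (abs_nonneg _) h1 2
  have h0 := hsq (z 0) (le_max_left _ _)
  have h1 := hsq (z 1) (le_max_right _ _)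
  have hm0 : (0 : ℝ) ≤ m := by positivity
  calc intNorm z = Real.sqrt (((z 0 : ℤ) : ℝ) ^ 2 + ((z 1 : ℤ) : ℝ) ^ 2) := rfl
    _ ≤ Real.sqrt (2 * (m : ℝ) ^ 2) := Real.sqrt_le_sqrt (by linarith)
    _ = Real.sqrt 2 * m := by
        rw [Real.sqrt_mul (by norm_num : (0:ℝ) ≤ 2), Real.sqrt_sq hm0]

/-- For every `M ≥ 1` and `z`, the pair correlation between `0` and `z` on `(ℤ/Mℤ)²` is at most
`1` (the a priori bound with `φ = 0`). [folklore] -/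
theorem norm_pairCorr_torusSiteOfInt_le_one (M : ℕ) [NeZero M] (t U μ β : ℝ) (hβ : 0 ≤ β)
    (z : Fin 2 → ℤ) :
    ‖(hubbardTorusWith 2 M t U μ).thermalCorr β
        (onSitePair (torusSiteOfInt M 0))ᴴ (onSitePair (torusSiteOfInt M z))‖ ≤ 1 := by
  have h0 := apriori_one M t U μ β hβ (torusSiteOfInt M 0) (torusSiteOfInt M z) (fun _ => 0)
  simp only [sub_self, mul_zero, Real.cosh_zero, ite_self, sum_const_zero, Real.exp_zero,
    mul_one] at h0
  exact h0

/-- **`PairEtaLineSharp` holds (bounds.tex Thm 10 (iii); Koma–Tasaki's Theorem with the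
McBryan–Spencer exponent `T/(π|t|)`, machine-checked).** For all real `t, U, μ`, `β > 0` and
`ε > 0` there is `R` such that for every `z ∈ ℤ²` with `|z| ≥ R`,
`limsup_{L→∞} |⟨c†_{0↑}c†_{0↓}c_{z↓}c_{z↑}⟩_{β,L}| ≤ |z|^{-(1-ε)/(πβ|t|)}`.
Proof: `norm_pairCorr_le_rpow_euclid` at `q* = 1/(2πβ|t|)` (`f* = 1/(πβ|t|)`); for `L + 1 >
2 max|z_i|` the torus distance from `0` to `z` is `max|z_i| ≥ |z|/√2`, so each term is
`≤ K(q*) (5√2)^{f*} |z|^{-f*} ≤ |z|^{-(1-ε) f*}` once `|z| ≥ (K(q*)(5√2)^{f*})^{1/(ε f*)}`;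
at `t = 0` the exponent is `0` and each term is `≤ 1`. -/
theorem pairEtaLineSharp_holds : PairEtaLineSharp := by
  intro t U μ β hβ ε hε
  have hcob : ∀ z : Fin 2 → ℤ, Filter.IsCoboundedUnder (· ≤ ·) Filter.atTop (fun L : ℕ =>
      ‖(hubbardTorusWith 2 (L + 1) t U μ).thermalCorr β
          (onSitePair (torusSiteOfInt (L + 1) 0))ᴴ (onSitePair (torusSiteOfInt (L + 1) z))‖) :=
    fun z => Filter.isCoboundedUnder_le_of_le _ (fun L => norm_nonneg _)
  by_cases ht : β * |t| = 0
  · -- `t = 0`: the exponent is the junk value `0`, the bound `1` holds termwise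
    refine ⟨0, fun z _ => ?_⟩
    have hexp : -((1 - ε) / (Real.pi * β * |t|)) = 0 := by
      rw [mul_assoc, ht, mul_zero, div_zero, neg_zero]
    rw [hexp, Real.rpow_zero]
    exact Filter.limsup_le_of_le (hcob z) (Filter.Eventually.of_forall fun L =>
      norm_pairCorr_torusSiteOfInt_le_one (L + 1) t U μ β hβ.le z)
  · -- `β|t| > 0`: the Euclidean dipole at `q* = 1/(2πβ|t|)`
    have hβt : 0 ≤ β * |t| := mul_nonneg hβ.le (abs_nonneg t)
    have hb0 : 0 < β * |t| := lt_of_le_of_ne hβt (Ne.symm ht)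
    have hπ := Real.pi_pos
    have hπb : Real.pi * β * |t| ≠ 0 := by
      rw [mul_assoc]; exact mul_ne_zero Real.pi_ne_zero ht
    set q : ℝ := 1 / (2 * Real.pi * (β * |t|)) with hq
    have hq0 : 0 ≤ q := by positivity
    set fs : ℝ := 4 * q - 4 * Real.pi * 1 * (β * |t|) * q ^ 2 with hfs
    have hfval : fs = 1 / (Real.pi * (β * |t|)) := by
      rw [hfs, hq]
      field_simp
      ring
    have hfpos : 0 < fs := by rw [hfval]; positivity
    set K : ℝ := Real.exp (2 * 1 * (β * |t|) *
      (2 * Real.pi * q ^ 2 + 76 * q ^ 2 + 544 * q ^ 4 * Real.exp (2 * q ^ 2))) with hK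
    have hK0 : 0 < K := Real.exp_pos _
    set K₂ : ℝ := K * (5 : ℝ) ^ fs * Real.sqrt 2 ^ fs with hK2
    have hK2pos : 0 < K₂ := by positivity
    set R₀ : ℝ := K₂ ^ (1 / (ε * fs)) with hR0
    refine ⟨max R₀ 1, fun z hz => ?_⟩
    have hN1 : 1 ≤ intNorm z := le_trans (le_max_right _ _) hz
    have hNR : R₀ ≤ intNorm z := le_trans (le_max_left _ _) hz
    have hN0 : 0 < intNorm z := by linarith
    -- `m = max |z_i| ≥ 1` and `|z| ≤ √2 m`
    set m : ℕ := max (z 0).natAbs (z 1).natAbs with hm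
    have hNm : intNorm z ≤ Real.sqrt 2 * m := intNorm_le_sqrt_two_mul z
    have hm1 : 1 ≤ m := by
      by_contra hm0
      have hm0' : m = 0 := by omega
      have h0 : z 0 = 0 := Int.natAbs_eq_zero.1 (by omega)
      have h1 : z 1 = 0 := Int.natAbs_eq_zero.1 (by omega)
      have : intNorm z = 0 := by
        simp [intNorm, h0, h1]
      linarith
    have hm0 : (0 : ℝ) < m := by exact_mod_cast hm1
    have hsqrt2 : 0 < Real.sqrt 2 := by positivity
    have hNdiv : intNorm z / Real.sqrt 2 ≤ (m : ℝ) + 1 := by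
      rw [div_le_iff₀ hsqrt2]
      nlinarith
    have hNdiv0 : 0 < intNorm z / Real.sqrt 2 := by positivity
    -- the exponent of the statement is `-(1-ε) f*`
    have hexp : -((1 - ε) / (Real.pi * β * |t|)) = -fs + ε * fs := by
      rw [hfval]
      field_simp
      ring
    -- termwise bound for `L + 1 > 2m`
    have hev : ∀ᶠ L : ℕ in Filter.atTop,
        ‖(hubbardTorusWith 2 (L + 1) t U μ).thermalCorr β
            (onSitePair (torusSiteOfInt (L + 1) 0))ᴴ (onSitePair (torusSiteOfInt (L + 1) z))‖ ≤
          K₂ * intNorm z ^ (-fs) := by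
      refine Filter.eventually_atTop.2 ⟨2 * m, fun L hL => ?_⟩
      have hdist : torusDist (torusSiteOfInt (L + 1) 0) (torusSiteOfInt (L + 1) z) = m :=
        torusDist_torusSiteOfInt_zero (L + 1) z (by omega)
      have hbound : ‖(hubbardTorusWith 2 (L + 1) t U μ).thermalCorr β
            (onSitePair (torusSiteOfInt (L + 1) 0))ᴴ (onSitePair (torusSiteOfInt (L + 1) z))‖ ≤
          K * ((5 : ℝ) ^ fs *
            ((torusDist (torusSiteOfInt (L + 1) 0) (torusSiteOfInt (L + 1) z) : ℝ) + 1) ^ (-fs)) :=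
        norm_pairCorr_le_rpow_euclid (L + 1) t U μ β q hβ.le hq0 hfpos.le _ _
      rw [hdist] at hbound
      calc ‖(hubbardTorusWith 2 (L + 1) t U μ).thermalCorr β
            (onSitePair (torusSiteOfInt (L + 1) 0))ᴴ (onSitePair (torusSiteOfInt (L + 1) z))‖
          ≤ K * ((5 : ℝ) ^ fs * ((m : ℝ) + 1) ^ (-fs)) := hbound
        _ ≤ K * ((5 : ℝ) ^ fs * (intNorm z / Real.sqrt 2) ^ (-fs)) := by
            gcongr K * ((5 : ℝ) ^ fs * ?_)
            exact Real.rpow_le_rpow_of_nonpos hNdiv0 hNdiv (by linarith)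
        _ = K₂ * intNorm z ^ (-fs) := by
            rw [Real.div_rpow hN0.le hsqrt2.le, Real.rpow_neg hsqrt2.le, div_inv_eq_mul, hK2]
            ring
    -- absorb the constant into the `ε`-slack
    have hK2le : K₂ ≤ intNorm z ^ (ε * fs) := by
      have h1 : R₀ ^ (ε * fs) ≤ intNorm z ^ (ε * fs) :=
        Real.rpow_le_rpow (by positivity) hNR (by positivity)
      have h2 : R₀ ^ (ε * fs) = K₂ := by
        rw [hR0, ← Real.rpow_mul hK2pos.le, one_div_mul_cancel (by positivity : ε * fs ≠ 0),
          Real.rpow_one]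
      rw [h2] at h1
      exact h1
    have hfinal : K₂ * intNorm z ^ (-fs) ≤ intNorm z ^ (-((1 - ε) / (Real.pi * β * |t|))) := by
      rw [hexp, Real.rpow_add hN0]
      have hpow0 : 0 ≤ intNorm z ^ (-fs) := Real.rpow_nonneg hN0.le _
      calc K₂ * intNorm z ^ (-fs) ≤ intNorm z ^ (ε * fs) * intNorm z ^ (-fs) := by gcongr
        _ = intNorm z ^ (-fs) * intNorm z ^ (ε * fs) := mul_comm _ _
    exact (Filter.limsup_le_of_le (hcob z) hev).trans hfinal

end Summit.HubbardSuperconductivity.HubbardLadder.Bounds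

end
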